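import Summits.BirchSwinnertonDyer.BirchSwinnertonDyer.Theses.MordellShaFreeCut
import Summits.BirchSwinnertonDyer.BirchSwinnertonDyer.Theorems.CongruentShaFreeCutTwoAdicControlOfPoitouTate
import Summits.BirchSwinnertonDyer.Rank1Residual.X11b.HalvesReceptacle
import Literature.NumberTheory.EllipticCurves.CastellaGrossiLeeSkinner2022.IMC2DivisibilityAndBDPValueFrame

set_option linter.dupNamespace false
set_option autoImplicit false

/-! # Route `MordellShaFreeCut` (rung S2b) — crux `AnalyticRankOneOfRankOneFiniteShaThree`
(stmt-BirchSwinnertonDyer-19160), line `three-adic-bdp-triple` (v5, skeleton 42213ef385753c26):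
the three BDP-currency statements NAMED and the PLUMBING stub PROVED — the SERVICE TWIN of
`CongruentShaFreeCutTwoAdicBDPTriple.lean` (S2, `2 ↦ 3`, `E_n ↦` the `j = 0` curve `W`)

Cell `bsd-cn100`, prover seat `bsd-cn100-s2-c3` (g5) as service for the S2b row, on the plan seat's
registered line of record
(`HOME/bsd-cn100-plan/routes-g11/bc/AnalyticRankOneOfRankOneFiniteShaThree_threeAdicBDPTriple_v5.lean`,
STATUS 2026-08-26T10:12:08Z). Supports, does not close, stmt-BirchSwinnertonDyer-19160. HONEST
FRAMING: nothing here proves crux B of S2b, the leaf `rankOne_threeConverse_jZero`-type statement or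
any case of BSD. Three OPEN statements are NAMED (`@[conjecture] def`, bodies VERBATIM from the
registered skeleton, nothing asserted) and ONE registered stub — the plumbing
`stub_heegnerNonTorsion_of_linkA_of_bdpTriple` — is PROVED with its registered name and signature.

## The three statements (OPEN at the additive prime `3`; typing model = the CGLS 2022 frames)

* `ThreeAdicBDPElementExists` (LB-exist) — a `3`-adic anticyclotomic BDP element for the newform of
  the `j = 0` curve over a Heegner field with `3 = v v̄` split (a CONSTRUCTION; X11b H1 shape).
* `ThreeAdicWanDivisibility` (LB-wan) — the `p`-CONVERSE divisibility `3^k · j_*(char_Λ 𝔛) ⊆ (𝓛)`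
  along every structure map `j : ℤ₃ → R₀`, for EVERY BDP element.
* `ThreeAdicBDPValueAtOne` (LB-bdp) — the BDP formula at the trivial character for every BDP element.

## The plumbing (PROVED, `stub_heegnerNonTorsion_of_linkA_of_bdpTriple`)

Verbatim the S2 argument with `2 ↦ 3`: Kato descends the rank-one data to `K`
(`AcPConverseLinks.rank_corank_sha_baseChange_of_twist_L_one_ne_zero`); the anticyclotomic datum, THE
embedding `ι = embAt`, `v = inducedPlace ι`, `v̄` (`X11b.exists_anticyclotomic_generator_degreeOnePrime`,
`X11b.exists_other_prime`); Link A gives a generator `F` of `char_Λ 𝔛` with `F(0) ≠ 0`;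
`IsHeegnerPoint` unfolds to `(Dt, H, ι_K)` and the Galois conjugate `P' = τ_* P` is the Heegner point
read through THE infinite place (`ComplexEmbedding.exists_comp_symm_eq_of_comp_eq`); (LB-exist)
supplies `(ι', Ω_K, Ω_p, 𝓛)`; (LB-wan) along `X11b.Halves.toUnr 3` gives `G · 𝓛 = 3^k · toUnr_* F`,
whence `𝓛(0) ≠ 0`; (LB-bdp) at `P'` and `UnrSeries.eq_constantCoeff_of_hasValueAt_zero` give
`log_ω P' ≠ 0`; a torsion `P` would make `P'` torsion and `log_ω P' = 0`
(`AcPConverseLinks.padicLogPoint_formalIndex_smul_eq_zero_of_isOfFinAddOrder`). No character supply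
or frame rigidity is used.

References: [CastellaGrossiLeeSkinner2022] Thm. 4.2.2, §5.1–5.2, Thm. 5.1.3; [Castella2018] Thm. 2.3,
Thm. 3.1, Thm. 3.2, Thm. 3.4; [CastellaHsieh2018] Def. 3.5, Prop. 3.6; [BertoliniDarmonPrasanna2013]
Thm. 5.13; [SilvermanAEC2009] IV.6.4, VII.2.2. -/

noncomputable section

open scoped Classical

namespace Summit.BirchSwinnertonDyer.BirchSwinnertonDyer.Theorems.MordellShaFreeCutThreeAdicBDPTriple

open PowerSeries WeierstrassCurve NumberField IsDedekindDomain Field Literature.NumberTheory.EllipticCurves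
  Literature.NumberTheory.EllipticCurves.ModularForms Literature.NumberTheory.QuadraticFields
  Literature.NumberTheory.EllipticCurves.Castella2018
open Summit.BirchSwinnertonDyer.BirchSwinnertonDyer.Theses.MordellShaFreeCut
open Summit.BirchSwinnertonDyer.BirchSwinnertonDyer.Theorems.MordellShaFreeCutThreeAdicLinks
open Literature.NumberTheory.GaloisRepresentations Literature.NumberTheory.GaloisCohomology

/-! ## 1. The three BDP-currency statements (OPEN; named, nothing asserted; bodies verbatim from
the registered skeleton 42213ef385753c26) -/

/-- (LB-exist) a `3`-adic anticyclotomic BDP element for the newform `Dt.f` of the `j = 0` curve `W`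
over a Heegner field `K` in which `3 = v v̄` splits, X11b H1 shape (`∃ ι'` inducing `v`, CM periods,
`𝓛 ∈ R₀⟦T⟧` with `IsBDPLFunction`): a CONSTRUCTION, open at the additive prime `3` (in print for
`p ∤ N`, `p ≥ 5`: Castella–Hsieh 2018 Prop. 3.6; `p ∥ N`: Castella 2018 Thm. 3.1).
[cite: Castella2018, Thm. 3.1 (shape)] [cite: CastellaHsieh2018, Def. 3.5 and Prop. 3.6 (shape)] -/
@[conjecture] def ThreeAdicBDPElementExists : Prop :=
  ∀ (W : WeierstrassCurve ℚ) [W.IsElliptic] [W.IsGloballyMinimal], W.j = 0 →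
    ∀ (K : Type) [Field K] [NumberField K] (N : ℕ) [NeZero N]
      (Dt : ModularParametrizationData W N)
      (v : HeightOneSpectrum (𝓞 K)) (κ : ZpExtension K 3) (γ : absoluteGaloisGroup K)
      [Fact (κ.IsTopGenerator γ)],
    W.conductorNorm ℤ = N → IsImaginaryQuadratic K →
    SatisfiesHeegnerHypothesis N K → ((Ideal.span {(3 : ℤ)}).primesOver (𝓞 K)).ncard = 2 →
    ((3 : ℕ) : 𝓞 K) ∈ v.asIdeal → κ.IsAnticyclotomic →
    ∃ ι' : PadicAlgCl 3 ≃+* ℂ,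
      (∀ (w : InfinitePlace K) (k : 𝓞 K), k ∈ v.asIdeal ↔ ‖ι'.symm (w.embedding (k : K))‖ < 1) ∧
      ∃ (ΩK : ℂ) (Ωp : (unrIntegers 3)ˣ) (L : UnrSeries 3),
        ΩK ≠ 0 ∧ IsBDPLFunction ι' v κ γ Dt.f ΩK ((Ωp : unrIntegers 3) : ℂ_[3]) L

/-- (LB-wan) the `p`-converse DIVISIBILITY of the `3`-adic anticyclotomic main conjecture for the
`j = 0` curve `W` (the Skinner–Urban / X. Wan, Eisenstein-congruence direction
`3^k · j_*(char_Λ 𝔛) ⊆ (𝓛)` along every structure map `j : ℤ₃ → R₀`, `𝔛 = X_ac^∅` at the strict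
place `v̄ ≠ v`), for EVERY BDP element of the frame (invariant under `𝓛 ↦ unit · 𝓛`; vacuous where
`𝔛` is not torsion). OPEN at the additive prime `3` (in print: `p ∤ 2N`, and only the OTHER direction
in CGLS 2022). [cite: CastellaGrossiLeeSkinner2022, Thm. 4.2.2 (shape of the other divisibility; nothing asserted)]
[cite: Castella2018, Thm. 3.4 (shape; nothing asserted)] -/
@[conjecture] def ThreeAdicWanDivisibility : Prop :=
  ∀ (W : WeierstrassCurve ℚ) [W.IsElliptic] [W.IsGloballyMinimal], W.j = 0 →
    ∀ (ι' : PadicAlgCl 3 ≃+* ℂ) (K : Type) [Field K] [NumberField K] (N : ℕ) [NeZero N]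
      (Dt : ModularParametrizationData W N)
      (v vbar : HeightOneSpectrum (𝓞 K)) (κ : ZpExtension K 3) (γ : absoluteGaloisGroup K)
      [Fact (κ.IsTopGenerator γ)],
    W.conductorNorm ℤ = N → IsImaginaryQuadratic K →
    SatisfiesHeegnerHypothesis N K → ((Ideal.span {(3 : ℤ)}).primesOver (𝓞 K)).ncard = 2 →
    (∀ (w : InfinitePlace K) (k : 𝓞 K), k ∈ v.asIdeal ↔ ‖ι'.symm (w.embedding (k : K))‖ < 1) →
    ((3 : ℕ) : 𝓞 K) ∈ vbar.asIdeal → vbar ≠ v → κ.IsAnticyclotomic →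
    ∀ (ΩK : ℂ) (Ωp : (unrIntegers 3)ˣ) (L : UnrSeries 3),
      ΩK ≠ 0 → IsBDPLFunction ι' v κ γ Dt.f ΩK ((Ωp : unrIntegers 3) : ℂ_[3]) L →
    ∀ (j : ℤ_[3] →+* unrIntegers 3),
      (∀ x : ℤ_[3], ((j x : unrIntegers 3) : ℂ_[3]) = algebraMap ℚ_[3] ℂ_[3] (x : ℚ_[3])) →
      ∃ k : ℕ, ∀ F ∈ AcSelmer.XAc.charIdeal (W.baseChange K) 3 κ vbar ∅ γ,
        C ((3 : unrIntegers 3) ^ k) * PowerSeries.map j F ∈ Ideal.span {L}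

/-- (LB-bdp) the BDP formula AT THE TRIVIAL CHARACTER for the `j = 0` curve `W` at the additive
prime `3`: `𝓛(𝟙) = u · c⁻² · (1 − a₃·3⁻¹ + [3 ∤ N]·3⁻¹)² · (log_ω P)²`, `u ∈ R₀ˣ`, general Euler factor
kept (`a₃ = W.LFunction 3`, the Dirichlet coefficient), `P` THE Heegner point `w(P) = heegnerPointComplex
Dt H`, `e : K → ℚ₃` inducing `v`, for EVERY BDP element of the frame. OPEN at `3 ∣ N` (in print:
`p ∤ 2N`). [cite: CastellaGrossiLeeSkinner2022, Thm. 5.1.3 (shape; nothing asserted)]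
[cite: BertoliniDarmonPrasanna2013, Thm. 5.13 (shape; nothing asserted)] -/
@[conjecture] def ThreeAdicBDPValueAtOne : Prop :=
  ∀ (W : WeierstrassCurve ℚ) [W.IsElliptic] [W.IsGloballyMinimal], W.j = 0 →
    ∀ (ι' : PadicAlgCl 3 ≃+* ℂ) (K : Type) [Field K] [NumberField K] (N : ℕ) [NeZero N]
      (Dt : ModularParametrizationData W N)
      (H : HeegnerDatum N (NumberField.discr K)) (w : InfinitePlace K) (e : K →+* ℚ_[3])
      (v : HeightOneSpectrum (𝓞 K)) (κ : ZpExtension K 3) (γ : absoluteGaloisGroup K)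
      [Fact (κ.IsTopGenerator γ)] (P : (W.baseChange K).toAffine.Point),
    W.conductorNorm ℤ = N → IsImaginaryQuadratic K →
    SatisfiesHeegnerHypothesis N K → ((Ideal.span {(3 : ℤ)}).primesOver (𝓞 K)).ncard = 2 →
    ((3 : ℕ) : 𝓞 K) ∈ v.asIdeal →
    (∀ (w' : InfinitePlace K) (k : 𝓞 K), k ∈ v.asIdeal ↔ ‖ι'.symm (w'.embedding (k : K))‖ < 1) →
    κ.IsAnticyclotomic →
    WeierstrassCurve.Affine.Point.map w.embedding.toRatAlgHom P = heegnerPointComplex Dt H →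
    (∀ k : 𝓞 K, k ∈ v.asIdeal ↔ ‖e (k : K)‖ < 1) →
    ∀ (ΩK : ℂ) (Ωp : (unrIntegers 3)ˣ) (L : UnrSeries 3),
      ΩK ≠ 0 → IsBDPLFunction ι' v κ γ Dt.f ΩK ((Ωp : unrIntegers 3) : ℂ_[3]) L →
      ∃ u : (unrIntegers 3)ˣ, L.HasValueAt 0
        (((u : unrIntegers 3) : ℂ_[3]) *
          algebraMap ℚ_[3] ℂ_[3] (((Dt.c : ℚ_[3])⁻¹) ^ 2 *
            (1 - (W.LFunction 3 : ℚ_[3]) * (3 : ℚ_[3])⁻¹ +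
              (if (3 : ℕ) ∣ N then 0 else (3 : ℚ_[3])⁻¹)) ^ 2 *
            (padicLogOmega W 3 e P) ^ 2))

/-! ## 2. The plumbing stub (PROVED; registered name and signature) -/

/-- **`stub_heegnerNonTorsion_of_linkA_of_bdpTriple`** (registered stub of line `three-adic-bdp-triple`
v5 on stmt-BirchSwinnertonDyer-19160; size M, PLUMBING — proved from tree material; twin of the S2
stub of the same name): Kato (`hKato`), Link A (`hA`: a generator `F` of `char_Λ 𝔛` with `F(0) ≠ 0`),
(LB-exist) (`hE`), (LB-wan) (`hWan`, along `toUnr : ℤ₃ → R₀`: `𝓛(0) ≠ 0`) and (LB-bdp) (`hV`: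
`𝓛(0) = u·c⁻²·(…)²·(log_ω P')²`) give `log_ω P' ≠ 0` for the Galois conjugate `P' = τ_* P` of the
Heegner point that is read through THE infinite place, hence `P'` and so `P` non-torsion.
CONDITIONAL on the four named inputs; credits nothing beyond the registered plumbing.
[cite: Castella2018, proof of Thm. 2.3 with Thm. 3.4 (the shape of this step)]
[cite: CastellaGrossiLeeSkinner2022, §5.2 (proof of Thm. 5.2.1)] [cite: SilvermanAEC2009, IV.6.4 and VII.2.2] -/
theorem stub_heegnerNonTorsion_of_linkA_of_bdpTriple
    (hKato : ∀ (W : WeierstrassCurve ℚ) [W.IsElliptic] (p : ℕ) [Fact p.Prime],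
      kato_finite_of_L_one_ne_zero W p)
    (hA : ThreeAdicControlOfRankOne) (hE : ThreeAdicBDPElementExists)
    (hWan : ThreeAdicWanDivisibility) (hV : ThreeAdicBDPValueAtOne) :
    ∀ (W : WeierstrassCurve ℚ) [W.IsElliptic] [W.IsGloballyMinimal], W.j = 0 →
      ∀ (K : Type) [Field K] [NumberField K] (N : ℕ) [NeZero N], W.conductorNorm ℤ = N →
        IsImaginaryQuadratic K → SatisfiesHeegnerHypothesis N K → SatisfiesHeegnerHypothesis 3 K →
          (W.quadraticTwist (NumberField.discr K : ℚ)).entireLFunction 1 ≠ 0 →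
            W.mordellWeilRank = 1 → Finite (AddCommGroup.primaryComponent W.sha 3) →
              ∀ (P : (W.baseChange K).toAffine.Point), IsHeegnerPoint N W K P →
                ¬ IsOfFinAddOrder P := by
  intro W _ _ hj K _ _ N _ hN hK hHN hH3 hL hrank hsha P hP
  -- (0) `3 = v v̄` splits in `K`
  have hsplit : ((Ideal.span {(3 : ℤ)}).primesOver (𝓞 K)).ncard = 2 := by
    simpa using hH3 3 Nat.prime_three (dvd_refl 3)
  -- (1) the rank-one data over `K` (Kato on the twist)
  obtain ⟨hrk, -, hshaK⟩ :=
    AcPConverseLinks.rank_corank_sha_baseChange_of_twist_L_one_ne_zero hKato W 3 hK hL hrank hsha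
  -- (2) the anticyclotomic datum `(κ, γ)`, THE embedding at a degree-one `𝔭 ∋ 3`, `v`, `v̄`
  obtain ⟨κ, γ, 𝔭, hκ, hγ, h𝔭, he, hf⟩ :=
    Summit.BirchSwinnertonDyer.Rank1Residual.X11b.exists_anticyclotomic_generator_degreeOnePrime
      3 K hK hH3
  haveI : Fact (κ.IsTopGenerator γ) := ⟨hγ⟩
  set ι : K →+* ℚ_[3] := Summit.BirchSwinnertonDyer.Rank1Residual.X11b.embAt K 3 𝔭 h𝔭 he hf
    with hιdef
  set v := Summit.BirchSwinnertonDyer.Rank1Residual.X11b.inducedPlace ι with hvdef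
  have hv : ∀ x : 𝓞 K, x ∈ v.asIdeal ↔ ‖ι (x : K)‖ < 1 :=
    Summit.BirchSwinnertonDyer.Rank1Residual.X11b.mem_inducedPlace_iff ι
  have hv3 : ((3 : ℕ) : 𝓞 K) ∈ v.asIdeal :=
    Summit.BirchSwinnertonDyer.Rank1Residual.X11b.natCast_mem_inducedPlace ι
  obtain ⟨vbar, hvbar, hne⟩ :=
    Summit.BirchSwinnertonDyer.Rank1Residual.X11b.exists_other_prime hH3 v hv3
  -- (3) Link A at this datum: a generator `F` of `char_Λ 𝔛` with `F(0) ≠ 0`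
  obtain ⟨m, -, F, hF, hF0, -⟩ := hA W hj K N hN hK hHN hH3 ι v vbar hv hvbar hne κ hκ γ hrk hshaK
  -- (4) the Heegner datum of `P`; the Galois conjugate `P'` read through THE infinite place `w₀`
  obtain ⟨Dt, H, ιK, hPι⟩ := hP
  obtain ⟨w₀⟩ := (inferInstance : Nonempty (InfinitePlace K))
  haveI : IsGalois ℚ K := by
    haveI : Algebra.IsQuadraticExtension ℚ K := ⟨hK.1⟩
    infer_instance
  obtain ⟨σ, hσ⟩ := ComplexEmbedding.exists_comp_symm_eq_of_comp_eq (k := ℚ) w₀.embedding ιK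
    (by ext x; simp)
  set τ : K →+* K := ((σ.symm : K ≃ₐ[ℚ] K) : K →+* K) with hτdef
  set P' := WeierstrassCurve.Affine.Point.map τ.toRatAlgHom P with hP'def
  have hP' : WeierstrassCurve.Affine.Point.map w₀.embedding.toRatAlgHom P' =
      heegnerPointComplex Dt H := by
    rw [hP'def, WeierstrassCurve.Affine.Point.map_map]
    have hcomp : w₀.embedding.toRatAlgHom.comp τ.toRatAlgHom = ιK.toRatAlgHom := by
      apply AlgHom.ext
      intro x
      have := RingHom.congr_fun hσ x
      simpa [hτdef] using this
    rw [hcomp]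
    exact hPι
  -- (5) (LB-exist): the BDP element at `(Dt, v, κ, γ)`
  obtain ⟨ι', hι', ΩK, Ωp, L, hΩK, hBDP⟩ := hE W hj K N Dt v κ γ hN hK hHN hsplit hv3 hκ
  -- (6) (LB-wan) along the structure map `toUnr : ℤ₃ → R₀` forces `𝓛(0) ≠ 0`
  obtain ⟨k, hk⟩ := hWan W hj ι' K N Dt v vbar κ γ hN hK hHN hsplit hι' hvbar hne hκ ΩK Ωp L hΩK
    hBDP (Summit.BirchSwinnertonDyer.Rank1Residual.X11b.Halves.toUnr 3)
    (Summit.BirchSwinnertonDyer.Rank1Residual.X11b.Halves.coe_toUnr 3)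
  have hFmem : F ∈ AcSelmer.XAc.charIdeal (W.baseChange K) 3 κ vbar ∅ γ := by
    rw [hF]; exact Ideal.mem_span_singleton_self F
  obtain ⟨G, hG⟩ := Ideal.mem_span_singleton'.mp (hk F hFmem)
  have hL0 : PowerSeries.constantCoeff L ≠ 0 := by
    intro h0
    have h1 := congrArg (fun S : UnrSeries 3 ↦ ((PowerSeries.constantCoeff S : unrIntegers 3) : ℂ_[3])) hG
    simp only [map_mul, h0, mul_zero, PowerSeries.constantCoeff_C,
      Summit.BirchSwinnertonDyer.Rank1Residual.X11b.CongruenceLimit.constantCoeff_map_apply, Subring.coe_mul,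
      Subring.coe_pow, Subring.coe_zero,
      Summit.BirchSwinnertonDyer.Rank1Residual.X11b.Halves.coe_toUnr] at h1
    have h3' : ((3 : unrIntegers 3) : ℂ_[3]) = (3 : ℂ_[3]) := by norm_cast
    rw [h3'] at h1
    have h3 : algebraMap ℚ_[3] ℂ_[3] ((PowerSeries.constantCoeff F : ℤ_[3]) : ℚ_[3]) = 0 := by
      rcases mul_eq_zero.mp h1.symm with h | h
      · exact absurd (pow_eq_zero_iff'.mp h).1 three_ne_zero
      · exact h
    rw [map_eq_zero_iff _ (algebraMap ℚ_[3] ℂ_[3]).injective] at h3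
    exact hF0 (PadicInt.coe_eq_zero.mp h3)
  -- (7) (LB-bdp) at `P'`: `𝓛(0) = u · c⁻² · (…)² · (log_ω P')²`
  obtain ⟨u, hu⟩ := hV W hj ι' K N Dt H w₀ ι v κ γ P' hN hK hHN hsplit hv3 hι' hκ hP' hv ΩK Ωp L
    hΩK hBDP
  have hval := UnrSeries.eq_constantCoeff_of_hasValueAt_zero hu
  -- (8) a torsion `P` makes `P'` torsion and `log_ω P' = 0`, contradicting `𝓛(0) ≠ 0`
  intro hPtor
  have hP'tor : IsOfFinAddOrder P' := by
    rw [hP'def]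
    exact AddMonoidHom.isOfFinAddOrder _ hPtor
  have hlog : padicLogOmega W 3 ι P' = 0 := by
    unfold padicLogOmega
    rw [AcPConverseLinks.padicLogPoint_formalIndex_smul_eq_zero_of_isOfFinAddOrder W 3 ι hP'tor,
      zero_div]
  apply hL0
  rw [hlog, zero_pow two_ne_zero, mul_zero, map_zero, mul_zero] at hval
  exact_mod_cast hval.symm

/-! ## 3. APPEND (bsd-cn100-s2b-c3 g3, 2026-08-26): crux B from the BDP triple — the attacked crux's
KERNEL CENSUS after v5 in ONE theorem (an independent proof of the plumbing by the s2b hand, token-identical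
statement, is kept unfiled as HOME/bsd-cn100-s2b-c3/MordellShaFreeCutThreeAdicBDPTriple.s2b-c3.lean) -/

/-- **Crux B `AnalyticRankOneOfRankOneFiniteShaThree` from the three BDP statements, Poitou–Tate and the
six refereed facts** (`3`-parity, modularity, Hoffstein–Luo, Kato, Gross 1984, Gross–Zagier + Kolyvagin):
the landed v2 composition `MordellShaFreeCutOfHeegnerNonTorsion.analyticRankOne_of_facts_of_heegnerNonTorsion`
(p419697) fed with the plumbing `stub_heegnerNonTorsion_of_linkA_of_bdpTriple`, Link A being the kernel
theorem `CongruentShaFreeCutTwoAdicControlOfPoitouTate.threeAdicControlOfRankOne_of_poitouTate hPT` (p432373).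
KERNEL CENSUS of the attacked crux of S2b after the v5 re-cut: research = (LB-exist)
`ThreeAdicBDPElementExists` + (LB-wan) `ThreeAdicWanDivisibility` + (LB-bdp) `ThreeAdicBDPValueAtOne`;
textbook = Poitou–Tate `poitouTate_sum_localTatePairing_eq_zero`; refereed = six named facts. CONDITIONAL;
credits nothing; nothing about BSD or the leaf `rankOne_threeConverse_mordellCurve` is proved.
[cite: GrossZagier1986, Thm. I.6.3 with V.§2] [cite: CastellaGrossiLeeSkinner2022, §5.2 (proof of Thm. 5.2.1)]
[cite: MilneADT2006, Ch. I, Thm. 4.10(b)] -/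
theorem cruxB_of_bdpTriple_of_poitouTate
    (hpar : ∀ (W : WeierstrassCurve ℚ) [W.IsElliptic] (p : ℕ) [Fact p.Prime], p_parity W p)
    (hmod : ModularForms.exists_isNewformOf) (hHL : HoffsteinLuo1997_exists_twist_L_one_ne_zero)
    (hKato : ∀ (W : WeierstrassCurve ℚ) [W.IsElliptic] (p : ℕ) [Fact p.Prime],
      kato_finite_of_L_one_ne_zero W p)
    (hHP : ∀ (W : WeierstrassCurve ℚ) (K : Type) [Field K] [NumberField K],
      exists_isHeegnerPoint W K)
    (hGZ : ∀ (W : WeierstrassCurve ℚ) (N : ℕ) [NeZero N] (K : Type) [Field K] [NumberField K],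
      analyticRankEK_eq_one_iff_heegner_nonTorsion W N K)
    (hPT : ∀ (K : Type) [Field K] [NumberField K], poitouTate_sum_localTatePairing_eq_zero K)
    (hE : ThreeAdicBDPElementExists) (hWan : ThreeAdicWanDivisibility) (hV : ThreeAdicBDPValueAtOne) :
    AnalyticRankOneOfRankOneFiniteShaThree :=
  MordellShaFreeCutOfHeegnerNonTorsion.analyticRankOne_of_facts_of_heegnerNonTorsion
    hpar hmod hHL hKato hHP hGZ
    (stub_heegnerNonTorsion_of_linkA_of_bdpTriple hKato
      (CongruentShaFreeCutTwoAdicControlOfPoitouTate.threeAdicControlOfRankOne_of_poitouTate hPT)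
      hE hWan hV)

end Summit.BirchSwinnertonDyer.BirchSwinnertonDyer.Theorems.MordellShaFreeCutThreeAdicBDPTriple

end
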